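import Summits.PneNP.PneNP.Theorems.SfmBlMachineDictPieces

/-!
# Line «sfm-bl», MACHINE LAYER M5 dictionary (D1c): the number of pieces (stmt-PneNP-20523)

FRONTIER F-N1c; nothing here bears on P vs NP.

The piece-count hypotheses `hN1 : 1 ≤ |α| + |β|` and `hN : |α| + |β| ≤ 2n + 1 + 6m/2^60` of
`SfmBl.cutCertified_of_pipeline` for the machine's piece structure of D1 (`LPiece L I`, `RPiece L I`): a left label
is `(0, c, rank/L)` with `c < n` and `rank <` the size `D_c` of the fibre of `c`, so at most `(D_c − 1)/L + 1` blocks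
per vertex and `Σ_c D_c ≤ 3m` (`card_LPiece_le`); likewise on the right with the `n + 1` vertex codes
(`card_RPiece_le`); together `card_pieces_le_real`, and `one_le_card_pieces` when `0 < m`.
-/

set_option linter.dupNamespace false -- `Summit.PneNP.PneNP.…`: summit = sub-problem name (D-0017 single-conjunct layout)

namespace Summit.PneNP.PneNP.Theorems.SfmBlMachine

open Literature.Computability.Complexity
open Summit.PneNP.PneNP.Theorems.Nc03AvoidResidualCoreCandFewHeadsRungFP (trips)

variable {n m : ℕ}

/-- The left fibre size of vertex `c`. -/
def fibL (trips : List (ℕ × ℕ × ℕ)) (c : ℕ) : ℕ :=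
  ((List.range (3 * trips.length)).filter fun i => lvert trips i = c).length

/-- The right fibre size of vertex code `v`. -/
def fibR (trips : List (ℕ × ℕ × ℕ)) (v : ℕ) : ℕ :=
  ((List.range (3 * trips.length)).filter fun i => rvert trips i = v).length

/-- The left rank is below the fibre size. -/
theorem rankL_lt_fibL (trips : List (ℕ × ℕ × ℕ)) {i : ℕ} (hi : i < 3 * trips.length) :
    rankL trips i < fibL trips (lvert trips i) := by
  unfold fibL
  rw [rankL_eq_countP trips hi, ← List.countP_eq_length_filter]
  have hsub : List.Sublist (List.range (i + 1)) (List.range (3 * trips.length)) := List.range_sublist.2 hi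
  have h1 := hsub.countP_le (p := fun k => decide (lvert trips k = lvert trips i))
  rw [List.range_succ, List.countP_append] at h1
  have h2 : List.countP (fun k => decide (lvert trips k = lvert trips i)) [i] = 1 := by simp
  omega

/-- The right rank is below the fibre size. -/
theorem rankR_lt_fibR (trips : List (ℕ × ℕ × ℕ)) {i : ℕ} (hi : i < 3 * trips.length) :
    rankR trips i < fibR trips (rvert trips i) := by
  unfold fibR
  rw [rankR_eq_countP trips hi, ← List.countP_eq_length_filter]
  have hsub : List.Sublist (List.range (i + 1)) (List.range (3 * trips.length)) := List.range_sublist.2 hi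
  have h1 := hsub.countP_le (p := fun k => decide (rvert trips k = rvert trips i))
  rw [List.range_succ, List.countP_append] at h1
  have h2 : List.countP (fun k => decide (rvert trips k = rvert trips i)) [i] = 1 := by simp
  omega

/-- The fibres partition the legs: `Σ_{c < B} D_c ≤ 3m`. -/
theorem sum_fibL_le (trips : List (ℕ × ℕ × ℕ)) (B : ℕ) : ∑ c ∈ Finset.range B, fibL trips c ≤ 3 * trips.length := by
  classical
  have h := Finset.card_eq_sum_card_fiberwise (s := (Finset.range (3 * trips.length)).filter fun i => lvert trips i < B)
    (t := Finset.range B) (f := lvert trips) (fun i hi => Finset.mem_range.2 (Finset.mem_filter.1 hi).2)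
  have hle : ((Finset.range (3 * trips.length)).filter fun i => lvert trips i < B).card ≤ 3 * trips.length :=
    (Finset.card_filter_le _ _).trans (by simp)
  rw [h] at hle
  refine le_trans (Finset.sum_le_sum fun c hc => ?_) hle
  unfold fibL
  have : ((Finset.range (3 * trips.length)).filter fun i => lvert trips i < B).filter (fun i => lvert trips i = c)
      = (Finset.range (3 * trips.length)).filter fun i => lvert trips i = c := by
    ext i; simp only [Finset.mem_filter, Finset.mem_range]
    constructor
    · rintro ⟨⟨h1, _⟩, h3⟩; exact ⟨h1, h3⟩
    · rintro ⟨h1, h3⟩; exact ⟨⟨h1, by rw [h3]; exact Finset.mem_range.1 hc⟩, h3⟩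
  rw [this]
  exact le_of_eq (by rfl)

/-- Same on the right. -/
theorem sum_fibR_le (trips : List (ℕ × ℕ × ℕ)) (B : ℕ) : ∑ v ∈ Finset.range B, fibR trips v ≤ 3 * trips.length := by
  classical
  have h := Finset.card_eq_sum_card_fiberwise (s := (Finset.range (3 * trips.length)).filter fun i => rvert trips i < B)
    (t := Finset.range B) (f := rvert trips) (fun i hi => Finset.mem_range.2 (Finset.mem_filter.1 hi).2)
  have hle : ((Finset.range (3 * trips.length)).filter fun i => rvert trips i < B).card ≤ 3 * trips.length :=
    (Finset.card_filter_le _ _).trans (by simp)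
  rw [h] at hle
  refine le_trans (Finset.sum_le_sum fun c hc => ?_) hle
  unfold fibR
  have : ((Finset.range (3 * trips.length)).filter fun i => rvert trips i < B).filter (fun i => rvert trips i = c)
      = (Finset.range (3 * trips.length)).filter fun i => rvert trips i = c := by
    ext i; simp only [Finset.mem_filter, Finset.mem_range]
    constructor
    · rintro ⟨⟨h1, _⟩, h3⟩; exact ⟨h1, h3⟩
    · rintro ⟨h1, h3⟩; exact ⟨⟨h1, by rw [h3]; exact Finset.mem_range.1 hc⟩, h3⟩
  rw [this]
  exact le_of_eq (by rfl)

/-- Summing integer quotients: `Σ (a_c / L) ≤ (Σ a_c) / L`. -/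
theorem sum_div_le_sum_div (s : Finset ℕ) (a : ℕ → ℕ) {L : ℕ} (hL : 0 < L) :
    ∑ c ∈ s, a c / L ≤ (∑ c ∈ s, a c) / L := by
  rw [Nat.le_div_iff_mul_le hL, Finset.sum_mul]
  exact Finset.sum_le_sum fun c _ => Nat.div_mul_le_self _ _

/-- **LEFT PIECES**: at most `n + 3m/L`. -/
theorem card_LPiece_le {L : ℕ} (hL : 0 < L) (I : LocalMap 3 n m) :
    Fintype.card (LPiece L I) ≤ n + 3 * m / L := by
  classical
  let box : Finset Lab := (Finset.range n).biUnion fun c =>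
    (Finset.range ((fibL (trips I) c - 1) / L + 1)).image fun b => ((0 : ℕ), c, b)
  have hmem : ∀ P : LPiece L I, P.1 ∈ box := by
    intro P
    obtain ⟨x, hx, hP⟩ := List.mem_map.1 P.2
    unfold pieceLegs at hx
    obtain ⟨i, hi, rfl⟩ := List.mem_map.1 hx
    rw [List.mem_range] at hi
    have hi' : i < 3 * m := by rw [length_trips] at hi; exact hi
    rw [← hP]
    show ((0 : ℕ), lvert (trips I) i, rankL (trips I) i / L) ∈ box
    have hc : lvert (trips I) i < n := by
      have := lvert_trips I ⟨i / 3, by omega⟩ (t := i % 3) (by omega)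
      rw [show 3 * (i / 3) + i % 3 = i by omega] at this
      rw [this]; exact (I.vars _ 0).isLt
    have hr := rankL_lt_fibL (trips I) hi
    refine Finset.mem_biUnion.2 ⟨lvert (trips I) i, Finset.mem_range.2 hc, Finset.mem_image.2 ⟨_, Finset.mem_range.2 ?_, rfl⟩⟩
    have : rankL (trips I) i / L ≤ (fibL (trips I) (lvert (trips I) i) - 1) / L := Nat.div_le_div_right (by omega)
    omega
  have hcard : Fintype.card (LPiece L I) ≤ box.card := by
    rw [← Finset.card_univ]
    refine Finset.card_le_card_of_injOn (fun P => P.1) (fun P _ => by exact hmem P) ?_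
    intro a _ b _ h; exact Subtype.ext h
  refine hcard.trans ?_
  calc box.card ≤ ∑ c ∈ Finset.range n, ((Finset.range ((fibL (trips I) c - 1) / L + 1)).image fun b => ((0 : ℕ), c, b)).card :=
        Finset.card_biUnion_le
    _ ≤ ∑ c ∈ Finset.range n, ((fibL (trips I) c - 1) / L + 1) :=
        Finset.sum_le_sum fun c _ => Finset.card_image_le.trans (by simp)
    _ = ∑ c ∈ Finset.range n, (fibL (trips I) c - 1) / L + n := by
        rw [Finset.sum_add_distrib, Finset.sum_const, Finset.card_range, smul_eq_mul, mul_one]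
    _ ≤ (∑ c ∈ Finset.range n, fibL (trips I) c) / L + n := by
        refine Nat.add_le_add_right ((sum_div_le_sum_div _ _ hL).trans (Nat.div_le_div_right
          (Finset.sum_le_sum fun c _ => Nat.sub_le _ _))) _
    _ ≤ 3 * m / L + n := by
        have := sum_fibL_le (trips I) n
        rw [length_trips] at this
        exact Nat.add_le_add_right (Nat.div_le_div_right this) _
    _ = n + 3 * m / L := by omega

/-- **RIGHT PIECES**: at most `(n + 1) + 3m/L` (vertex codes `0, …, n`). -/
theorem card_RPiece_le {L : ℕ} (hL : 0 < L) (I : LocalMap 3 n m) :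
    Fintype.card (RPiece L I) ≤ (n + 1) + 3 * m / L := by
  classical
  let box : Finset Lab := (Finset.range (n + 1)).biUnion fun v =>
    (Finset.range ((fibR (trips I) v - 1) / L + 1)).image fun b => ((1 : ℕ), v, b)
  have hmem : ∀ Q : RPiece L I, Q.1 ∈ box := by
    intro Q
    obtain ⟨x, hx, hQ⟩ := List.mem_map.1 Q.2
    unfold pieceLegs at hx
    obtain ⟨i, hi, rfl⟩ := List.mem_map.1 hx
    rw [List.mem_range] at hi
    have hi' : i < 3 * m := by rw [length_trips] at hi; exact hi
    have hv : rvert (trips I) i ≤ n := by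
      have := rvertex_le L I Q
      rw [← hQ] at this; exact this
    rw [← hQ]
    show ((1 : ℕ), rvert (trips I) i, rankR (trips I) i / L) ∈ box
    have hr := rankR_lt_fibR (trips I) hi
    refine Finset.mem_biUnion.2 ⟨rvert (trips I) i, Finset.mem_range.2 (by omega), Finset.mem_image.2 ⟨_, Finset.mem_range.2 ?_, rfl⟩⟩
    have : rankR (trips I) i / L ≤ (fibR (trips I) (rvert (trips I) i) - 1) / L := Nat.div_le_div_right (by omega)
    omega
  have hcard : Fintype.card (RPiece L I) ≤ box.card := by
    rw [← Finset.card_univ]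
    refine Finset.card_le_card_of_injOn (fun Q => Q.1) (fun Q _ => by exact hmem Q) ?_
    intro a _ b _ h; exact Subtype.ext h
  refine hcard.trans ?_
  calc box.card ≤ ∑ v ∈ Finset.range (n + 1), ((Finset.range ((fibR (trips I) v - 1) / L + 1)).image fun b => ((1 : ℕ), v, b)).card :=
        Finset.card_biUnion_le
    _ ≤ ∑ v ∈ Finset.range (n + 1), ((fibR (trips I) v - 1) / L + 1) :=
        Finset.sum_le_sum fun v _ => Finset.card_image_le.trans (by simp)
    _ = ∑ v ∈ Finset.range (n + 1), (fibR (trips I) v - 1) / L + (n + 1) := by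
        rw [Finset.sum_add_distrib, Finset.sum_const, Finset.card_range, smul_eq_mul, mul_one]
    _ ≤ (∑ v ∈ Finset.range (n + 1), fibR (trips I) v) / L + (n + 1) := by
        refine Nat.add_le_add_right ((sum_div_le_sum_div _ _ hL).trans (Nat.div_le_div_right
          (Finset.sum_le_sum fun v _ => Nat.sub_le _ _))) _
    _ ≤ 3 * m / L + (n + 1) := by
        have := sum_fibR_le (trips I) (n + 1)
        rw [length_trips] at this
        exact Nat.add_le_add_right (Nat.div_le_div_right this) _
    _ = (n + 1) + 3 * m / L := by omega

/-- **hN**: `|α| + |β| ≤ 2n + 1 + 6m/L` (reals), for the machine's piece structure. -/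
theorem card_pieces_le_real {L : ℕ} (hL : 0 < L) (I : LocalMap 3 n m) :
    ((Fintype.card (LPiece L I) : ℝ) + Fintype.card (RPiece L I)) ≤ 2 * n + 1 + 6 * m / L := by
  have h1 := card_LPiece_le hL I
  have h2 := card_RPiece_le hL I
  have hdiv : ((3 * m / L : ℕ) : ℝ) ≤ 3 * (m : ℝ) / L := by
    have := Nat.cast_div_le (m := 3 * m) (n := L) (α := ℝ)
    push_cast at this; exact this
  have e1 : (Fintype.card (LPiece L I) : ℝ) ≤ n + ((3 * m / L : ℕ) : ℝ) := by exact_mod_cast h1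
  have e2 : (Fintype.card (RPiece L I) : ℝ) ≤ (n + 1) + ((3 * m / L : ℕ) : ℝ) := by exact_mod_cast h2
  have : 6 * (m : ℝ) / L = 3 * m / L + 3 * m / L := by ring
  rw [this]; linarith

/-- **hN1**: with at least one output there is at least one piece. -/
theorem one_le_card_pieces (L : ℕ) (I : LocalMap 3 n m) (hm : 0 < m) :
    1 ≤ Fintype.card (LPiece L I) + Fintype.card (RPiece L I) := by
  have : 0 < Fintype.card (LPiece L I) :=
    Fintype.card_pos_iff.2 ⟨srcM L I (⟨0, hm⟩, 0)⟩
  omega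

end Summit.PneNP.PneNP.Theorems.SfmBlMachine
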